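import Literature.NumberTheory.EllipticCurves.HuShuYin2019.SylvesterTowerTwoTorsion
import Literature.NumberTheory.EllipticCurves.JZeroKolyvaginPrimes
import Literature.NumberTheory.EllipticCurves.GaloisAction
import HarnessLib

/-!
# No `Γ_K`-fixed `2`-power torsion in `E_n(K̄)` for the cube-sum curves over `K = ℚ(ω)` — the displayed
# input `hfix` («`E(K)[2^κ] = 0`») of the Kolyvagin-pair first-case data, PROVED

Topic `NumberTheory/EllipticCurves/HuShuYin2019`, namespace `Literature.NumberTheory.EllipticCurves` (`.JZero`,
`.HuShuYin2019`). THEOREMS ONLY (no definition, no named fact, no instance, no notation; D-0026, net debt 0).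
Cell `bsd-cm`, row `bsd-cm-k-ty1` ((M1)(K-ty) wrapper for VARIANT K on crux 19804 `UpperOffV0HSYPlus`), twelfth
seating, OFFER #34 (planner D629 GO); `--supports stmt-BirchSwinnertonDyer-19804`.

The TAIL's value cut (McCallum Thm. 5.4 for a Kolyvagin pair, tree `exists_firstCaseData_kolyvagin`) displays
`hfix : ∀ P : geomTorsion W (m : ℤ), (∀ σ : Γ_K, σ • P = P) → P = 0` («`E(K)[m] = 0`», `m = 2^κ`) in
GEOMETRIC-POINTS currency; for the cube-sum curves `E_n : y² = x³ − 432 n²`, `n` odd, over `K = ℚ(ω)` every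
ingredient is in the tree in `K`-RATIONAL currency, and this file does the Galois descent:

* §1 `geomTorsion_eq_zero_of_forall_smul_eq` — `V/F`, `F` perfect, `N : ℤ`: if `V(F)` has no non-zero point
  killed by `N` then `V(F̄)^{Γ_F}[N] = 0` (`V(F̄)^{Γ_F} = V(F)`, tree `fixedPoints_eq_range_map_holds`,
  Silverman I.§1 / VIII.§1; base change of points is injective, Mathlib `Affine.Point.map_injective`);
* §2 `JZero.geomTorsion_eq_zero_of_forall_smul_eq` — `y² = x³ + b`, `char K = 0`, `x³ + b` rootless in `K`:
  no `Γ_K`-fixed geometric `2^k`-torsion (tree `JZero.eq_zero_of_two_pow_smul_eq_zero`, Silverman–Tate 2.1(a));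
* §3 ★ `HuShuYin2019.cubeSumCurve_geomTorsion_eq_zero_of_forall_smul_eq` — `K` a number field with
  `ω² + ω + 1 = 0`, `[K:ℚ] = 2` (so `d_K = −3` and `2n²` is not a cube in `K`, tree
  `JZero.discr_eq_neg_three_of_sq_add_self_add_one` / `pow_three_ne_two_mul_sq`), `n` odd, `m = 2^k`:
  `∀ P : geomTorsion ((cubeSumCurve n)⁄K) (m : ℤ), (∀ σ, σ • P = P) → P = 0` — VERBATIM the binder `hfix`
  for `E_9`, `E_p`, `E_{3p²}` (`p` odd) in the rows' currency (`hω`, `h2`).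

HONEST FRAMING: Galois descent + the `2`-torsion of `y² = x³ + b` + `∛(2n²) ∉ ℚ(ω)`; nothing about `L`-functions,
Selmer groups, `Ш` or BSD is asserted; no summit statement is touched; X12.CMAtTwo is NOT proved.

## References

* J. H. Silverman, *The Arithmetic of Elliptic Curves*, 2nd ed. (2009), I.§1 and VIII.§1 (proof of
  Prop. 1.2: `E(K̄)^{G_{K̄/K}} = E(K)`). [SilvermanAEC2009]
* J. H. Silverman, J. Tate, *Rational Points on Elliptic Curves*, 2nd ed. (2015), §2.1 Thm. 2.1(a).
  [SilvermanTate2015]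
* Y. Hu, J. Shu, H. Yin, *An explicit Gross–Zagier formula related to the Sylvester conjecture*,
  Trans. AMS 372 (2019); arXiv:1708.05266, §2. [HuShuYin2019]
* W. G. McCallum, *Kolyvagin's work on Shafarevich–Tate groups*, LMS LN 153 (1991), §5 (proof of Thm. 5.4:
  "`E(K)` has no `p`-torsion"). [McCallumLMS1991]

## Mathlib / tree search
Tree: `fixedPoints_eq_range_map_holds`, `JZero.eq_zero_of_two_pow_smul_eq_zero`,
`HuShuYin2019.cubeSumCurve_eq_zero_of_two_pow_smul_eq_zero`, `pow_three_ne_two_mul_sq`,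
`JZero.discr_eq_neg_three_of_sq_add_self_add_one`; Mathlib `Affine.Point.map_injective`.
`lean search 'fixed.*geomPoints|geomTorsion.*fixed|of_forall_smul_eq'` → no geometric-torsion form in the tree.
-/

noncomputable section

open scoped Classical

namespace Literature.NumberTheory.EllipticCurves

open _root_.WeierstrassCurve Field NumberField

universe u

/-! ### §1. Galois descent for torsion points -/

/-- **`V(F̄)^{Γ_F}[N] = 0` from `V(F)[N] = 0`** (`V/F`, `F` perfect, `N : ℤ`): if the only `F`-rational `Q`
with `N • Q = O` is `O`, then every `Γ_F`-fixed geometric `P` with `N • P = O` is `O` — `V(F̄)^{Γ_F} = V(F)`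
(Silverman, `K` perfect) and base change of points is an injective homomorphism.
[cite: SilvermanAEC2009, I.§1 and VIII.§1 (proof of Prop. 1.2)] -/
theorem geomTorsion_eq_zero_of_forall_smul_eq {F : Type u} [Field F] [PerfectField F]
    (V : WeierstrassCurve F) (N : ℤ)
    (hV : ∀ Q : (V.baseChange F).toAffine.Point, N • Q = 0 → Q = 0)
    (P : geomTorsion V N) (hP : ∀ σ : absoluteGaloisGroup F, σ • P = P) : P = 0 := by
  have hfix : (P : geomPoints V) ∈ MulAction.fixedPoints (absoluteGaloisGroup F) (geomPoints V) := by
    intro σ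
    rw [← AddSubgroup.torsionBy.coe_smul, hP σ]
  rw [fixedPoints_eq_range_map_holds V] at hfix
  obtain ⟨Q, hQ⟩ := hfix
  have hNP : N • (P : geomPoints V) = 0 := (mem_geomTorsion_iff V N _).mp P.2
  have hNQ : N • Q = 0 := by
    apply Affine.Point.map_injective (F := F) (f := Algebra.ofId F (AlgebraicClosure F))
    change Affine.Point.baseChange F (AlgebraicClosure F) (N • Q) =
      Affine.Point.baseChange F (AlgebraicClosure F) 0
    rw [map_zsmul, map_zero]
    exact (congrArg (fun R : geomPoints V ↦ N • R) hQ).trans hNP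
  have hQ0 : Q = 0 := hV Q hNQ
  rw [hQ0] at hQ
  apply Subtype.ext
  change (P : geomPoints V) = 0
  rw [← hQ]
  exact map_zero (Affine.Point.baseChange F (AlgebraicClosure F))

/-! ### §2. `y² = x³ + b` with `x³ + b` rootless in `K`: no `Γ_K`-fixed geometric `2`-power torsion -/

namespace JZero

/-- **No `Γ_K`-fixed `2`-power torsion on `y² = x³ + b` when `x³ + b` has no root in `K`** (`char K = 0`,
`m = 2^k`): geometric form of `JZero.eq_zero_of_two_pow_smul_eq_zero` (Silverman–Tate 2.1(a)) via §1.
[cite: SilvermanTate2015, §2.1, Thm. 2.1(a)] [cite: SilvermanAEC2009, VIII.§1 (proof of Prop. 1.2)] -/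
theorem geomTorsion_eq_zero_of_forall_smul_eq {K : Type u} [Field K] [CharZero K] {b : K}
    (hb : ∀ x : K, x ^ 3 + b ≠ 0) {m : ℕ} {k : ℕ} (hm : m = 2 ^ k)
    (P : geomTorsion (⟨0, 0, 0, 0, b⟩ : WeierstrassCurve K) (m : ℤ))
    (hP : ∀ σ : absoluteGaloisGroup K, σ • P = P) : P = 0 := by
  refine Literature.NumberTheory.EllipticCurves.geomTorsion_eq_zero_of_forall_smul_eq _ _ ?_ P hP
  have hmap : (⟨0, 0, 0, 0, b⟩ : WeierstrassCurve K).baseChange K = ⟨0, 0, 0, 0, b⟩ := by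
    ext <;> simp [WeierstrassCurve.baseChange, WeierstrassCurve.map]
  have key : ∀ V : WeierstrassCurve K, V = ⟨0, 0, 0, 0, b⟩ →
      ∀ Q : V.toAffine.Point, (m : ℤ) • Q = 0 → Q = 0 := by
    rintro V rfl Q hQ
    refine eq_zero_of_two_pow_smul_eq_zero two_ne_zero hb k Q ?_
    rw [← hm, ← natCast_zsmul]
    exact hQ
  exact key _ hmap

end JZero

/-! ### §3. ★ The cube-sum curves over `K = ℚ(ω)`: the rows' `hfix` -/

namespace HuShuYin2019

/-- **★ `E_n(K̄)^{Γ_K}[2^k] = 0` for the cube-sum curve `E_n : y² = x³ − 432 n²`, `n` odd, over `K = ℚ(ω)`**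
(`ω² + ω + 1 = 0`, `[K:ℚ] = 2`; so `d_K = −3`, `2n²` is not a cube in `K`, `E_n(K)[2^∞] = 0`): with `m = 2^k`,
every `Γ_K`-fixed `P ∈ E_n(K̄)` with `m • P = O` is `O` — VERBATIM the displayed `hfix` («`E(K)[2^κ] = 0`»,
McCallum §5) of `exists_firstCaseData_kolyvagin` for `E_9`, `E_p`, `E_{3p²}` (`p` odd). [cite: HuShuYin2019, §2]
[cite: SilvermanTate2015, §2.1, Thm. 2.1(a)] [cite: SilvermanAEC2009, VIII.§1] [cite: McCallumLMS1991, §5] -/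
theorem cubeSumCurve_geomTorsion_eq_zero_of_forall_smul_eq {K : Type} [Field K] [NumberField K]
    {ω : K} (hω : ω ^ 2 + ω + 1 = 0) (h2 : Module.finrank ℚ K = 2)
    {n : ℚ} (hn : ∃ n₀ : ℤ, Odd n₀ ∧ (n₀ : ℚ) = n) {m : ℕ} {k : ℕ} (hm : m = 2 ^ k)
    (P : geomTorsion ((cubeSumCurve n).baseChange K) (m : ℤ))
    (hP : ∀ σ : absoluteGaloisGroup K, σ • P = P) : P = 0 := by
  refine Literature.NumberTheory.EllipticCurves.geomTorsion_eq_zero_of_forall_smul_eq _ _ ?_ P hP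
  have hK : IsImaginaryQuadratic K := JZero.isImaginaryQuadratic_of_sq_add_self_add_one hω h2
  have hdK : Odd (NumberField.discr K) := by
    rw [JZero.discr_eq_neg_three_of_sq_add_self_add_one hω h2]; decide
  obtain ⟨n₀, hn₀, rfl⟩ := hn
  have hF : ∀ t : K, t ^ 3 ≠ 2 * ((n₀ : ℚ) : K) ^ 2 := fun t ↦ by
    rw [Rat.cast_intCast]; exact pow_three_ne_two_mul_sq hK hdK hn₀ t
  have hmap : ((cubeSumCurve (n₀ : ℚ)).baseChange K).baseChange K = (cubeSumCurve (n₀ : ℚ)).baseChange K :=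
    (cubeSumCurve (n₀ : ℚ)).map_baseChange (Algebra.ofId K K)
  have key : ∀ V : WeierstrassCurve K, V = (cubeSumCurve (n₀ : ℚ)).baseChange K →
      ∀ Q : V.toAffine.Point, (m : ℤ) • Q = 0 → Q = 0 := by
    rintro V rfl Q hQ
    refine cubeSumCurve_eq_zero_of_two_pow_smul_eq_zero (F := K) (n₀ : ℚ) hF k Q ?_
    rw [← hm, ← natCast_zsmul]
    exact hQ
  exact key _ hmap

end HuShuYin2019

end Literature.NumberTheory.EllipticCurves

end
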